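import Literature.NumberTheory.LFunctions.CertifiedDirichletLTuringTrudgian
import Literature.NumberTheory.LFunctions.CertifiedDirichletLTuringMethodZeroCountProofs
import Literature.NumberTheory.LFunctions.RademacherDirichletLConvexity
import Literature.NumberTheory.LFunctions.ZetaConvexityExplicit
import HarnessLib

/-!
# Trudgian 2011, §3.4: the upper bound for `∫_{1/2}^∞ log|L(σ + it, χ)| dσ` (Lemma 3.6), proved

T. S. Trudgian, *Improvements to Turing's method*, Math. Comp. **80** (2011) 2259–2279, §3.4
(statement numbering checked against arXiv:0903.1885, pp. 8–10).  Companion of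
`CertifiedDirichletLTuringTrudgian.lean` (the named facts `trudgian2011_theorem38/33` and the
constants `Trudgian2011Dirichlet.aConst/bConst/logZeta`).  This file PROVES the first half of the
proof of Theorem 3.8 — every statement here is a theorem, no new named fact:

* `Trudgian2011Dirichlet.norm_one_add_div_le` — "if `σ ≤ 5/4` and `t > t₀` it is easy to show
  that `|1+s|/t ≤ 1 + 81/(32t₀²) = 1 + ε`" (p. 9, display before (3.5 alive)).
* `Trudgian2011Dirichlet.log_norm_LFunction_le_of_mem_Icc` — Lemma 3.5 (Rademacher, the tree's
  `Rademacher1959.norm_LFunction_le` at `η = c − 1`) in logarithmic form with `ε`: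
  for `½ ≤ σ ≤ c`, `t > t₀ > 0`, `log|L(s, χ)| ≤ ((c−σ)/2)(log(Qt/2π) + ε) + log ζ(c)`.
* `Trudgian2011Dirichlet.log_norm_LFunction_le_logZeta` — "for `σ ≥ c > 1` one can write
  `|L(s, χ)| = |Σ χ(n)n^{−s}| ≤ Σ n^{−σ} = ζ(σ)`" (in logarithmic form).
* `Trudgian2011Dirichlet.trudgian2011_lemma36` — **Lemma 3.6:** "If `t > t₀ > 0` and `c` is a
  parameter satisfying `1 < c ≤ 5/4`, then … `∫_{½+it}^{∞+it} log|L(s, χ)| dσ ≤ a₁ + b₁ log(Qt/2π)`,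
  where (3.·) `a₁ = 729/(2048t₀²) + (c − ½) log ζ(c) + ∫_c^∞ log|ζ(σ)| dσ` and `b₁ = ¼(c − ½)²`."
  (Typed for `t` not the ordinate of a zero of `L(s, χ)` in the critical strip — the case used by
  Turing's method; then `log|L(σ + it, χ)|` is a genuine integrable function on `(½, ∞)`,
  `TuringDirichlet.integrableOn_log_norm_LFunction`.)
* `Trudgian2011Dirichlet.pi_mul_integral_lfunctionArgS_le_of_lower_bound` — the assembly step "Lemmas 3.4,
  3.6 and 3.7 prove at once Theorem 3.8": Littlewood's lemma (the tree's
  `TuringDirichlet.pi_mul_integral_lfunctionArgS_eq`, Lemma 3.4) and Lemma 3.6, combined with ANY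
  lower bound `−∫_{½}^{∞} log|L(σ+it₁, χ)| dσ ≤ a₂ + b₂ log(Qt₁/2π)` (`b₂ ≥ 0`; Lemma 3.7 is such a
  bound, not proved here), give `π ∫_{t₁}^{t₂} S(t, χ) dt ≤ (a₁ + a₂) + (b₁ + b₂) log(Qt₂/2π)` for
  `t₀ < t₁ ≤ t₂`.

Conventions as in the companion files: `L(s, χ) = χ.LFunction s`, `S(t, χ) = lfunctionArgS χ t`,
`log ζ(σ) = Trudgian2011Dirichlet.logZeta σ = Real.log (riemannZeta σ).re` (`= log‖ζ(σ)‖` for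
`σ > 1`, `Booker2006Turing.bigZ_eq_norm`), `Q = q` the conductor of the primitive `χ`.

## References
* T. S. Trudgian, Improvements to Turing's method, Math. Comp. 80 (2011) 2259–2279, §3.4
  Lemmas 3.4–3.6, Theorem 3.8. [Trudgian2011]
* H. Rademacher, Math. Z. 72 (1959), Theorem 3 (the tree's `RademacherDirichletLConvexity.lean`).
  [Rademacher1959]
-/

noncomputable section

open Complex Set MeasureTheory intervalIntegral DirichletCharacter
open scoped Real

namespace Literature.NumberTheory.LFunctions

open ExplicitPsiChar

namespace Trudgian2011Dirichlet

variable {q : ℕ} [NeZero q]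

/-- `|z|² = (Re z)² + (Im z)²`. [folklore] -/
private lemma norm_sq_eq (z : ℂ) : ‖z‖ ^ 2 = z.re ^ 2 + z.im ^ 2 := by
  rw [Complex.sq_norm, Complex.normSq_apply]; ring

/-- **Trudgian 2011, §3.4 (arXiv:0903.1885, p. 9):** "if `σ ≤ 5/4` and `t > t₀` it is easy to show that
`|1+s|/t ≤ 1 + 81/(32t₀²) = 1 + ε`" (here for `−13/4 ≤ σ ≤ 5/4`, i.e. `|1+σ| ≤ 9/4`, which covers
the source's range `½ ≤ σ ≤ c ≤ 5/4`). [cite: Trudgian2011, §3.4 (display before Lemma 3.6)] -/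
theorem norm_one_add_div_le {t₀ : ℝ} (ht₀ : 0 < t₀) {s : ℂ} (h₁ : -13 / 4 ≤ s.re)
    (h₂ : s.re ≤ 5 / 4) (ht : t₀ < s.im) :
    ‖1 + s‖ / s.im ≤ 1 + 81 / (32 * t₀ ^ 2) := by
  have htpos : 0 < s.im := ht₀.trans ht
  set u : ℝ := 81 / (32 * s.im ^ 2) with hu
  have hu0 : 0 ≤ u := by positivity
  have hsq : ‖1 + s‖ ^ 2 ≤ (s.im * (1 + u)) ^ 2 := by
    rw [norm_sq_eq, add_re, one_re, add_im, one_im, zero_add]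
    have h1 : (1 + s.re) ^ 2 ≤ (9 / 4 : ℝ) ^ 2 := sq_le_sq' (by linarith) (by linarith)
    have h2 : (s.im * (1 + u)) ^ 2 = s.im ^ 2 + 2 * u * s.im ^ 2 + u ^ 2 * s.im ^ 2 := by ring
    have h3 : 2 * u * s.im ^ 2 = 81 / 16 := by
      rw [hu]; field_simp; ring
    nlinarith [sq_nonneg (u * s.im)]
  have hle : ‖1 + s‖ ≤ s.im * (1 + u) :=
    (pow_le_pow_iff_left₀ (norm_nonneg _) (by positivity) two_ne_zero).mp hsq
  rw [div_le_iff₀ htpos]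
  calc ‖1 + s‖ ≤ s.im * (1 + u) := hle
    _ ≤ s.im * (1 + 81 / (32 * t₀ ^ 2)) := by
        refine mul_le_mul_of_nonneg_left ?_ htpos.le
        rw [hu]
        gcongr
    _ = (1 + 81 / (32 * t₀ ^ 2)) * s.im := mul_comm _ _

/-- **Lemma 3.5 (Rademacher) in logarithmic form with Trudgian's `ε`** (§3.4; arXiv:0903.1885, p. 9: "In
preparation for taking the logarithm of both sides of (3.5) note that for `½ ≤ σ ≤ c` and `t ≥ t₀`,
one can find an `ε > 0` such that `log(|1+s|/t) ≤ ε`"): for a primitive `χ` modulo `Q > 1`,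
`1 < c ≤ 5/4`, `t > t₀ > 0` and `½ ≤ σ ≤ c` with `L(s, χ) ≠ 0`,
`log|L(s, χ)| ≤ ((c − σ)/2)(log(Qt/2π) + 81/(32t₀²)) + log ζ(c)`.
[cite: Trudgian2011, §3.4 Lemma 3.5 and the display following it] -/
theorem log_norm_LFunction_le_of_mem_Icc (hq : 1 < q) {χ : DirichletCharacter ℂ q}
    (hχ : χ.IsPrimitive) {c t₀ : ℝ} (hc1 : 1 < c) (hc : c ≤ 5 / 4) (ht₀ : 0 < t₀) {s : ℂ}
    (h₁ : 1 / 2 ≤ s.re) (h₂ : s.re ≤ c) (ht : t₀ < s.im) (hL : χ.LFunction s ≠ 0) :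
    Real.log ‖χ.LFunction s‖ ≤
      (c - s.re) / 2 * (Real.log (q * s.im / (2 * π)) + 81 / (32 * t₀ ^ 2)) + logZeta c := by
  have hqR : (0 : ℝ) < q := by exact_mod_cast (show 0 < q by omega)
  have htpos : 0 < s.im := ht₀.trans ht
  -- Rademacher's Theorem 3 with `η = c - 1`
  have hR := Rademacher1959.log_norm_LFunction_le hq hχ (η := c - 1) (by linarith) (by linarith)
    (s := s) (by linarith) (by linarith) hL
  have e1 : (1 : ℂ) + ((c - 1 : ℝ) : ℂ) = (c : ℂ) := by push_cast; ring
  have e2 : (1 + (c - 1) - s.re) / 2 = (c - s.re) / 2 := by ring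
  rw [e1, e2] at hR
  refine hR.trans ?_
  change (c - s.re) / 2 * Real.log (q * ‖1 + s‖ / (2 * π)) + Real.log (riemannZeta c).re ≤
    (c - s.re) / 2 * (Real.log (q * s.im / (2 * π)) + 81 / (32 * t₀ ^ 2)) + logZeta c
  have hlog : Real.log (q * ‖1 + s‖ / (2 * π)) ≤ Real.log (q * s.im / (2 * π)) + 81 / (32 * t₀ ^ 2) := by
    have h1s : 0 < ‖(1 : ℂ) + s‖ := by
      refine norm_pos_iff.mpr fun h0 ↦ ?_
      have := congrArg re h0
      rw [add_re, one_re, zero_re] at this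
      linarith
    have hsplit : (q : ℝ) * ‖(1 : ℂ) + s‖ / (2 * π) = q * s.im / (2 * π) * (‖(1 : ℂ) + s‖ / s.im) := by
      field_simp
    rw [hsplit, Real.log_mul (by positivity) (by positivity)]
    gcongr
    have hd : ‖(1 : ℂ) + s‖ / s.im ≤ 1 + 81 / (32 * t₀ ^ 2) :=
      norm_one_add_div_le ht₀ (by linarith) (by linarith) ht
    calc Real.log (‖(1 : ℂ) + s‖ / s.im) ≤ ‖(1 : ℂ) + s‖ / s.im - 1 :=
          Real.log_le_sub_one_of_pos (by positivity)
      _ ≤ 81 / (32 * t₀ ^ 2) := by linarith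
  have hcoef : 0 ≤ (c - s.re) / 2 := by linarith
  have := mul_le_mul_of_nonneg_left hlog hcoef
  unfold logZeta
  linarith

/-- **Trudgian 2011, §3.4 (arXiv:0903.1885, p. 9):** "for `σ ≥ c > 1` one can write
`|L(s, χ)| = |Σ_{n=1}^∞ χ(n)n^{−s}| ≤ Σ_{n=1}^∞ n^{−σ} = ζ(σ)`", in logarithmic form:
`log|L(σ + it, χ)| ≤ log ζ(σ)` for `σ > 1` (`L(σ + it, χ) ≠ 0` there).
[cite: Trudgian2011, §3.4 (display before Lemma 3.6)] -/
theorem log_norm_LFunction_le_logZeta (χ : DirichletCharacter ℂ q) {σ : ℝ} (hσ : 1 < σ) (t : ℝ) :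
    Real.log ‖χ.LFunction (σ + t * I)‖ ≤ logZeta σ := by
  have hne : χ.LFunction (σ + t * I) ≠ 0 :=
    LFunction_ne_zero_of_one_le_re χ (Or.inr fun h ↦ by
      have := congrArg re h; simp at this; linarith) (by simp; linarith)
  have h := Booker2006Turing.norm_LFunction_le_bigZ χ hσ t
  rw [Booker2006Turing.bigZ] at h
  exact Real.log_le_log (norm_pos_iff.mpr hne) h

/-- Splitting `∫_{(a, ∞)} = ∫_a^b + ∫_{(b, ∞)}` for an integrable function. [folklore] -/
private lemma setIntegral_Ioi_eq_add {f : ℝ → ℝ} {a b : ℝ} (hab : a ≤ b)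
    (hf : IntegrableOn f (Ioi a)) :
    ∫ x in Ioi a, f x = (∫ x in a..b, f x) + ∫ x in Ioi b, f x := by
  rw [intervalIntegral.integral_of_le hab, ← setIntegral_union (Set.Ioc_disjoint_Ioi le_rfl)
    measurableSet_Ioi (hf.mono_set Ioc_subset_Ioi_self) (hf.mono_set (Ioi_subset_Ioi hab)),
    Ioc_union_Ioi_eq_Ioi hab]

/-- No zero of `L(s, χ)` on the half-line `σ ≥ ½` at height `t`, when `t` is not the ordinate of a
zero in the critical strip. [folklore] -/
private lemma LFunction_ne_zero_of_half_le {χ : DirichletCharacter ℂ q} (h1 : χ ≠ 1) {t : ℝ}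
    (hz : ∀ ρ ∈ charNontrivialZeros χ, ρ.im ≠ t) {σ : ℝ} (hσ : 1 / 2 ≤ σ) :
    χ.LFunction (σ + t * I) ≠ 0 := by
  intro h0
  rcases lt_or_ge σ 1 with hσ1 | hσ1
  · exact hz _ (mem_charNontrivialZeros.2 ⟨h0, by simp; linarith, by simpa using hσ1⟩) (by simp)
  · exact LFunction_ne_zero_of_one_le_re χ (Or.inl h1) (by simpa using hσ1) h0

/-- **Trudgian 2011, Lemma 3.6 (§3.4; arXiv:0903.1885, p. 9), as printed:** "If `t > t₀ > 0` and
`c` is a parameter satisfying `1 < c ≤ 5/4`, then [throughout the region `½ ≤ σ ≤ c`] the following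
estimate holds `∫_{½+it}^{∞+it} log|L(s, χ)| dσ ≤ a₁ + b₁ log(Qt/2π)`, where
`a₁ = 729/(2048t₀²) + (c − ½) log ζ(c) + ∫_c^∞ log|ζ(σ)| dσ`, and `b₁ = ¼(c − ½)²`."  Setting of
§3.2: `χ` primitive of conductor `Q > 1`; typed for `t` not the ordinate of a zero of `L(s, χ)` with
`0 < Re s < 1` (the case used in Turing's method, where the integral is a Lebesgue integral of an
integrable function).  Proof as printed: split at `σ = c`; on `[½, c]` Lemma 3.5 (Rademacher) with
`log(|1+s|/t) ≤ ε = 81/(32t₀²)`, `∫_{½}^{c} (c−σ)/2 dσ = ¼(c−½)²`, `¼(c−½)²ε ≤ 729/(2048t₀²)`; on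
`[c, ∞)` `|L| ≤ ζ(σ)`. [cite: Trudgian2011, §3.4 Lemma 3.6] -/
theorem trudgian2011_lemma36 (hq : 1 < q) {χ : DirichletCharacter ℂ q} (hχ : χ.IsPrimitive)
    {c t₀ t : ℝ} (hc1 : 1 < c) (hc : c ≤ 5 / 4) (ht₀ : 0 < t₀) (ht : t₀ < t)
    (hz : ∀ ρ ∈ charNontrivialZeros χ, ρ.im ≠ t) :
    ∫ σ in Ioi (1 / 2 : ℝ), Real.log ‖χ.LFunction (σ + t * I)‖ ≤
      (729 / (2048 * t₀ ^ 2) + (c - 1 / 2) * logZeta c + ∫ σ in Ioi c, logZeta σ) +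
        (c - 1 / 2) ^ 2 / 4 * Real.log (q * t / (2 * π)) := by
  have hq1 : q ≠ 1 := by omega
  have h1 : χ ≠ 1 := SelbergDirichlet.ne_one_of_isPrimitive hq1 hχ
  have hc' : (1 / 2 : ℝ) ≤ c := by linarith
  set f : ℝ → ℝ := fun σ ↦ Real.log ‖χ.LFunction (σ + t * I)‖ with hf
  set L : ℝ := Real.log (q * t / (2 * π)) with hL
  set ε : ℝ := 81 / (32 * t₀ ^ 2) with hε
  have hI : IntegrableOn f (Ioi (1 / 2 : ℝ)) := TuringDirichlet.integrableOn_log_norm_LFunction h1 hz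
  rw [setIntegral_Ioi_eq_add hc' hI]
  -- the piece `[1/2, c]`
  set g : ℝ → ℝ := fun σ ↦ -((L + ε) / 2) * σ + (c * (L + ε) / 2 + logZeta c) with hg
  have hfg : ∀ σ ∈ Icc (1 / 2 : ℝ) c, f σ ≤ g σ := by
    intro σ hσ
    have hne := LFunction_ne_zero_of_half_le h1 hz hσ.1
    have h := log_norm_LFunction_le_of_mem_Icc hq hχ hc1 hc ht₀ (s := σ + t * I)
      (by simpa using hσ.1) (by simpa using hσ.2) (by simpa using ht) hne
    simp only [add_re, ofReal_re, mul_re, I_re, I_im, ofReal_im, mul_zero, sub_zero, mul_one,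
      add_zero, add_im, mul_im, zero_add] at h
    rw [hg]
    simp only [hf]
    linarith
  have hgi : ∫ σ in (1 / 2 : ℝ)..c, g σ = (L + ε) * ((c - 1 / 2) ^ 2 / 4) + (c - 1 / 2) * logZeta c := by
    rw [hg, intervalIntegral.integral_add, intervalIntegral.integral_const_mul, integral_id,
      intervalIntegral.integral_const, smul_eq_mul]
    · ring
    · exact (continuous_const.mul continuous_id).intervalIntegrable _ _
    · exact intervalIntegrable_const
  have hpiece1 : ∫ σ in (1 / 2 : ℝ)..c, f σ ≤ (L + ε) * ((c - 1 / 2) ^ 2 / 4) + (c - 1 / 2) * logZeta c := by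
    rw [← hgi]
    refine intervalIntegral.integral_mono_on hc'
      ((intervalIntegrable_iff_integrableOn_Ioc_of_le hc').mpr (hI.mono_set Ioc_subset_Ioi_self))
      ?_ hfg
    · exact ((continuous_const.mul continuous_id).add continuous_const).intervalIntegrable _ _
  -- the piece `[c, ∞)`
  have hpiece2 : ∫ σ in Ioi c, f σ ≤ ∫ σ in Ioi c, logZeta σ := by
    have hζI : IntegrableOn (fun σ : ℝ ↦ Real.log ‖riemannZeta σ‖) (Ioi c) :=
      integrableOn_log_norm_riemannZeta_ofReal hc1
    have heq : ∫ σ in Ioi c, logZeta σ = ∫ σ in Ioi c, Real.log ‖riemannZeta σ‖ := by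
      refine setIntegral_congr_fun measurableSet_Ioi fun σ hσ ↦ ?_
      have hσ1 : 1 < σ := hc1.trans hσ
      change Real.log (riemannZeta σ).re = Real.log ‖riemannZeta σ‖
      rw [← Booker2006Turing.bigZ_eq_norm hσ1, Booker2006Turing.bigZ]
    rw [heq]
    refine setIntegral_mono_on (hI.mono_set (Ioi_subset_Ioi hc')) hζI measurableSet_Ioi
      fun σ hσ ↦ ?_
    have hσ1 : 1 < σ := hc1.trans hσ
    have h := log_norm_LFunction_le_logZeta χ hσ1 t
    simp only [hf]
    rwa [logZeta, ← Booker2006Turing.bigZ, Booker2006Turing.bigZ_eq_norm hσ1] at h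
  -- `(c - 1/2)²/4 · ε ≤ 729/(2048 t₀²)`
  have hεterm : (L + ε) * ((c - 1 / 2) ^ 2 / 4) ≤ 729 / (2048 * t₀ ^ 2) + (c - 1 / 2) ^ 2 / 4 * L := by
    have hsq : (c - 1 / 2) ^ 2 ≤ (3 / 4 : ℝ) ^ 2 := sq_le_sq' (by linarith) (by linarith)
    have hε0 : 0 ≤ ε := by positivity
    have : (c - 1 / 2) ^ 2 / 4 * ε ≤ (3 / 4 : ℝ) ^ 2 / 4 * ε := by gcongr
    have e : (3 / 4 : ℝ) ^ 2 / 4 * ε = 729 / (2048 * t₀ ^ 2) := by rw [hε]; field_simp; ring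
    nlinarith
  linarith

/-- **Trudgian 2011, §3.4, the assembly "Lemmas 3.4, 3.6 and 3.7 prove at once Theorem 3.8"
(arXiv:0903.1885, p. 10), upper half made explicit:** Littlewood's lemma (Lemma 3.4, the tree's
`TuringDirichlet.pi_mul_integral_lfunctionArgS_eq`) and Lemma 3.6 at height `t₂`, combined with a
lower bound `−∫_{½}^{∞} log|L(σ + it₁, χ)| dσ ≤ a₂ + b₂ log(Qt₁/2π)` at height `t₁` (`b₂ ≥ 0`; the
content of Lemma 3.7, taken here as a hypothesis), give
`π ∫_{t₁}^{t₂} S(t, χ) dt ≤ (a₁ + a₂) + (b₁ + b₂) log(Qt₂/2π)` for `t₀ < t₁ ≤ t₂`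
(`log(Qt₁/2π) ≤ log(Qt₂/2π)` is used with the non-negative weight `b₂`).
[cite: Trudgian2011, §3.4 Theorem 3.8 (proof)] -/
theorem pi_mul_integral_lfunctionArgS_le_of_lower_bound (hq : 1 < q) {χ : DirichletCharacter ℂ q}
    (hχ : χ.IsPrimitive) {c t₀ t₁ t₂ a₂ b₂ : ℝ} (hc1 : 1 < c) (hc : c ≤ 5 / 4) (ht₀ : 0 < t₀)
    (h01 : t₀ < t₁) (h12 : t₁ ≤ t₂) (hb₂ : 0 ≤ b₂)
    (hz₁ : ∀ ρ ∈ charNontrivialZeros χ, ρ.im ≠ t₁) (hz₂ : ∀ ρ ∈ charNontrivialZeros χ, ρ.im ≠ t₂)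
    (hlow : -∫ σ in Ioi (1 / 2 : ℝ), Real.log ‖χ.LFunction (σ + t₁ * I)‖ ≤
      a₂ + b₂ * Real.log (q * t₁ / (2 * π))) :
    π * ∫ t in t₁..t₂, lfunctionArgS χ t ≤
      (729 / (2048 * t₀ ^ 2) + (c - 1 / 2) * logZeta c + (∫ σ in Ioi c, logZeta σ) + a₂) +
        ((c - 1 / 2) ^ 2 / 4 + b₂) * Real.log (q * t₂ / (2 * π)) := by
  have hqR : (0 : ℝ) < q := by exact_mod_cast (show 0 < q by omega)
  have ht₁ : 0 < t₁ := ht₀.trans h01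
  rw [TuringDirichlet.pi_mul_integral_lfunctionArgS_eq hχ hq h12 hz₁ hz₂]
  have hup := trudgian2011_lemma36 hq hχ hc1 hc ht₀ (h01.trans_le h12) hz₂
  have hlog : Real.log (q * t₁ / (2 * π)) ≤ Real.log (q * t₂ / (2 * π)) := by
    refine Real.log_le_log (by positivity) ?_
    gcongr
  have := mul_le_mul_of_nonneg_left hlog hb₂
  linarith

end Trudgian2011Dirichlet

end Literature.NumberTheory.LFunctions

end
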